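import Summits.KontsevichZagierPeriods.Zeta5Search.Barrier.ConeGammaLemmaFWin
import Summits.KontsevichZagierPeriods.Zeta5Search.Barrier.ConeGammaLemmaFBoxCert

/-!
# ζ(5) search — BARRIER: kernel enclosures of the WINDOWED Lemma F bound with members — SOUNDNESS, part 1
# (the sawtooth cell sums, the window / tail identities, the member pattern)

HONEST FRAMING (cell `pub-zeta5`): systematic search; no irrationality claim unless kernel-certified. Kernel ARITHMETIC
about the explicit real expression `winForm` (= the right-hand side of P2 g24's `phi30_le_windows_members`, VERBATIM, file
`ConeGammaLemmaFWin`); MODEL-side objects under BZ (28)+(30) ((28) observed, not proved). Nothing here is about C₀ / C₁ /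
δ₂₈, any γ, the cone's sup, C2 (OPEN), S-E (CONJECTURED), (TD_A) or `ζ(5)`; records in print UNMOVED. Theory seat cert-2 g35
(item «WINDOWED LEMMA F NUMERICS IN THE KERNEL — POINTS»), part 2a.

* `dG_cell`, `dG_split`, `dG_symm`, **`deltaEnc_sound`** / `deltaE_sound` — `δ(P/M, Q/M) ∈ deltaE M P Q` (induction over the
  integer cells; each cell is P2 g24's `integral_fract_div_sq_cell`);
* **`jT_window`** — `jT x U − jT x V = x·(δ(U,V) − δ(Ux,Vx))` (adjacent intervals; the logarithms cancel EXACTLY, so every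
  finite-window term is rational); **`jT_tail`** — `jT x U = x log x + x·δ(U,Ux)`;
* `jWinEnc_sound`, `jTailEnc_sound`, `memShapeEnc_sound` (the 25-term member pattern, orientation read off the integers),
  `memC_eq_cnt`.
-/

open Finset Set MeasureTheory
open Literature.Analysis.ValidatedNumerics.NumericsMP

namespace Summit.KontsevichZagierPeriods.Zeta5Search.Barrier.ConeGamma

namespace LemmaFWin

open LemmaFBox (SC lnNat SC_pos)

/-! ### δ: one cell, splitting, symmetry, and the enclosure -/

/-- The zero interval encloses `0`. -/
theorem mem_zI : MI.mem SC (0 : ℝ) zI := by simp [MI.mem, zI]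

/-- One integer cell: `δ(R,S) = −n(1/R − 1/S)` for `n ≤ R ≤ S ≤ n+1` (P2 g24's `integral_fract_div_sq_cell`). -/
theorem dG_cell (n : ℕ) {R S : ℝ} (hR : 0 < R) (hRS : R ≤ S) (hnR : (n : ℝ) ≤ R) (hSn : S ≤ n + 1) :
    dG R S = -((n : ℝ) * (1 / R - 1 / S)) := by
  unfold dG
  have h := integral_fract_div_sq_cell (n : ℤ) hR hRS (by exact_mod_cast hnR) (by exact_mod_cast hSn)
  rw [h]; push_cast; ring

/-- `δ` is additive over adjacent intervals in `(0, ∞)`. -/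
theorem dG_split {a b c : ℝ} (ha : 0 < a) (hab : a ≤ b) (hbc : b ≤ c) : dG a c = dG a b + dG b c := by
  have hb : 0 < b := ha.trans_le hab
  have hc : 0 < c := hb.trans_le hbc
  unfold dG
  rw [← intervalIntegral.integral_add_adjacent_intervals (intervalIntegrable_fract_div_sq ha hb)
    (intervalIntegrable_fract_div_sq hb hc),
    Real.log_div hc.ne' ha.ne', Real.log_div hb.ne' ha.ne', Real.log_div hc.ne' hb.ne']
  ring

/-- `δ(a,b) = −δ(b,a)`. -/
theorem dG_symm {a b : ℝ} (ha : 0 < a) (hb : 0 < b) : dG a b = -dG b a := by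
  unfold dG
  rw [intervalIntegral.integral_symm b a, Real.log_div hb.ne' ha.ne', Real.log_div ha.ne' hb.ne']
  ring

/-- One cell term encloses `−n(M/P − M/Q)`. -/
theorem cellTerm_sound (M n : ℕ) {P Q : ℕ} (hP : 0 < P) (hQ : 0 < Q) :
    MI.mem SC (-((n : ℝ) * ((M : ℝ) / P - (M : ℝ) / Q))) (cellTerm M n P Q) := by
  have h := MI.mem_sub (MI.mem_ofFrac SC ((n * M : ℕ) : ℤ) hQ) (MI.mem_ofFrac SC ((n * M : ℕ) : ℤ) hP)
  unfold cellTerm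
  convert h using 2
  push_cast; ring

/-- **Soundness of the cell recursion**: `δ(P/M, Q/M) ∈ deltaEnc M fuel P Q` whenever the fuel exceeds the cell count. -/
theorem deltaEnc_sound {M : ℕ} (hM : 0 < M) :
    ∀ (fuel P Q : ℕ), 0 < P → P ≤ Q → (Q - 1) / M - P / M < fuel →
      MI.mem SC (dG ((P : ℝ) / M) ((Q : ℝ) / M)) (deltaEnc M fuel P Q)
  | 0, _, _, _, _, h => absurd h (Nat.not_lt_zero _)
  | fuel + 1, P, Q, hP, hPQ, hfuel => by
    have hM' : (0 : ℝ) < M := by exact_mod_cast hM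
    have hP' : (0 : ℝ) < P := by exact_mod_cast hP
    have hR : (0 : ℝ) < (P : ℝ) / M := by positivity
    have hn : ((P / M : ℕ) : ℝ) ≤ (P : ℝ) / M := by
      rw [le_div_iff₀ hM']; exact_mod_cast Nat.div_mul_le_self P M
    have hlt : P < (P / M + 1) * M := by
      have := Nat.lt_div_mul_add (a := P) hM; linarith
    have hP'real : (((P / M + 1) * M : ℕ) : ℝ) / M = ((P / M : ℕ) : ℝ) + 1 := by
      push_cast; field_simp
    simp only [deltaEnc]
    split_ifs with h1
    · -- a single cell
      have hRS : (P : ℝ) / M ≤ (Q : ℝ) / M := div_le_div_of_nonneg_right (by exact_mod_cast hPQ) hM'.le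
      have hSn : (Q : ℝ) / M ≤ ((P / M : ℕ) : ℝ) + 1 := by
        rw [← hP'real]; exact div_le_div_of_nonneg_right (by exact_mod_cast h1) hM'.le
      rw [dG_cell (P / M) hR hRS hn hSn]
      have h := cellTerm_sound M (P / M) hP (hP.trans_le hPQ)
      convert h using 2
      rw [one_div_div, one_div_div]
    · -- several cells: split off the first one
      have hP'Q : (P / M + 1) * M < Q := not_le.mp h1
      have hPP' : (P : ℝ) / M ≤ (((P / M + 1) * M : ℕ) : ℝ) / M :=
        div_le_div_of_nonneg_right (by exact_mod_cast hlt.le) hM'.le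
      have hP'Q' : (((P / M + 1) * M : ℕ) : ℝ) / M ≤ (Q : ℝ) / M :=
        div_le_div_of_nonneg_right (by exact_mod_cast hP'Q.le) hM'.le
      rw [dG_split hR hPP' hP'Q']
      refine MI.mem_add ?_ ?_
      · rw [dG_cell (P / M) hR hPP' hn hP'real.le]
        have h := cellTerm_sound M (P / M) hP (hP.trans hlt)
        convert h using 2
        rw [one_div_div, one_div_div]
      · refine deltaEnc_sound hM fuel _ Q (hP.trans hlt) hP'Q.le ?_
        rw [Nat.mul_div_cancel _ hM]
        have h2 : P / M + 1 ≤ (Q - 1) / M := (Nat.le_div_iff_mul_le hM).mpr (Nat.le_sub_one_of_lt hP'Q)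
        omega

/-- `δ(P/M, Q/M) ∈ deltaE M P Q` for `0 < P ≤ Q`. -/
theorem deltaE_sound {M P Q : ℕ} (hM : 0 < M) (hP : 0 < P) (hPQ : P ≤ Q) :
    MI.mem SC (dG ((P : ℝ) / M) ((Q : ℝ) / M)) (deltaE M P Q) :=
  deltaEnc_sound hM _ P Q hP hPQ (Nat.lt_succ_self _)

/-! ### The window and tail identities for the `J`-terms -/

/-- `jT 0 R = 0`. -/
theorem jT_zero (R : ℝ) : jT 0 R = 0 := by simp [jT]

/-- **Finite window**: `jT x U − jT x V = x·(δ(U,V) − δ(Ux,Vx))` — the logarithms cancel exactly. -/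
theorem jT_window {x U V : ℝ} (hx : 0 < x) (hU : 0 < U) (hV : 0 < V) :
    jT x U - jT x V = x * (dG U V - dG (U * x) (V * x)) := by
  have hUx : 0 < U * x := mul_pos hU hx
  have hVx : 0 < V * x := mul_pos hV hx
  have i1 := intervalIntegral.integral_add_adjacent_intervals (intervalIntegrable_fract_div_sq hU hV)
    (intervalIntegrable_fract_div_sq hV hUx)
  have i2 := intervalIntegral.integral_add_adjacent_intervals (intervalIntegrable_fract_div_sq hV hUx)
    (intervalIntegrable_fract_div_sq hUx hVx)
  have hlog : Real.log (V * x / (U * x)) = Real.log (V / U) := by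
    rw [mul_div_mul_right _ _ hx.ne']
  unfold jT dG
  rw [hlog, ← i1, ← i2]
  ring

/-- **Tail**: `jT x U = x·log x + x·δ(U, Ux)`. -/
theorem jT_tail (x : ℝ) {U : ℝ} (hU : 0 < U) : jT x U = x * Real.log x + x * dG U (U * x) := by
  unfold jT dG
  rw [mul_div_cancel_left₀ _ hU.ne']
  ring

/-! ### Soundness of the `J`-enclosers -/

/-- A cast identity: `(A/E)·(X/D) = (A·X)/(E·D)`. -/
theorem frac_mul_frac (A E X D : ℝ) : A / E * (X / D) = A * X / (E * D) := by
  rw [div_mul_div_comm]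

/-- **Window encloser**: for `X ≥ 0`, `jWinEnc` encloses `jT x U − jT x V` (`x = X/D`, `U = A/E ≤ V = A'/E`). -/
theorem jWinEnc_sound {D E A A' : ℕ} (hD : 0 < D) (hE : 0 < E) (hA : 0 < A) (hAA' : A ≤ A') {dUV : MI}
    (hd : MI.mem SC (dG ((A : ℝ) / E) ((A' : ℝ) / E)) dUV) {X : ℤ} (hX : 0 ≤ X) :
    MI.mem SC (jT ((X : ℝ) / D) ((A : ℝ) / E) - jT ((X : ℝ) / D) ((A' : ℝ) / E)) (jWinEnc D E A A' dUV X) := by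
  unfold jWinEnc
  split_ifs with h0
  · have : X = 0 := le_antisymm h0 hX
    subst this
    simp only [Int.cast_zero, zero_div, jT_zero, sub_zero]
    exact mem_zI
  · have hXpos : 0 < X := lt_of_not_ge h0
    have hXn : ((X.toNat : ℕ) : ℤ) = X := Int.toNat_of_nonneg hX
    have hXr : ((X.toNat : ℕ) : ℝ) = (X : ℝ) := by exact_mod_cast hXn
    have hXn0 : 0 < X.toNat := by omega
    have hD' : (0 : ℝ) < D := by exact_mod_cast hD
    have hE' : (0 : ℝ) < E := by exact_mod_cast hE
    have hx : (0 : ℝ) < (X : ℝ) / D := by positivity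
    have hU : (0 : ℝ) < (A : ℝ) / E := by positivity
    have hV : (0 : ℝ) < (A' : ℝ) / E := by
      have : (0 : ℝ) < A' := by exact_mod_cast hA.trans_le hAA'
      positivity
    rw [jT_window hx hU hV]
    have hδ := deltaE_sound (M := E * D) (P := A * X.toNat) (Q := A' * X.toNat) (Nat.mul_pos hE hD)
      (Nat.mul_pos hA hXn0) (Nat.mul_le_mul_right _ hAA')
    have e1 : ((A * X.toNat : ℕ) : ℝ) / ((E * D : ℕ) : ℝ) = (A : ℝ) / E * ((X : ℝ) / D) := by
      push_cast; rw [hXr, frac_mul_frac]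
    have e2 : ((A' * X.toNat : ℕ) : ℝ) / ((E * D : ℕ) : ℝ) = (A' : ℝ) / E * ((X : ℝ) / D) := by
      push_cast; rw [hXr, frac_mul_frac]
    rw [e1, e2] at hδ
    have h := MI.mem_divNat (MI.mem_mulInt (MI.mem_sub hd hδ) X) hD
    convert h using 1
    ring

/-- What `tailPred` says for a positive numerator. -/
theorem tailPred_pos {X : ℤ} (hX : 0 < X) (h : tailPred X = true) : ∃ LX, lnNat X.toNat = some LX := by
  simp only [tailPred, Bool.or_eq_true, decide_eq_true_eq] at h
  rcases h with h | h
  · omega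
  · exact Option.isSome_iff_exists.mp h

/-- **Tail encloser**: for `X ≥ 0` passing `tailPred`, `jTailEnc` encloses `jT x U` (`x = X/D`, `U = A/E`;
`LD ∋ log D`). -/
theorem jTailEnc_sound {D E A : ℕ} (hD : 0 < D) (hE : 0 < E) (hA : 0 < A) {LD : MI}
    (hLD : MI.mem SC (Real.log D) LD) {X : ℤ} (hX : 0 ≤ X) (hp : tailPred X = true) :
    MI.mem SC (jT ((X : ℝ) / D) ((A : ℝ) / E)) (jTailEnc D E A LD X) := by
  unfold jTailEnc
  by_cases h0 : X ≤ 0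
  · rw [if_pos h0]
    have : X = 0 := le_antisymm h0 hX
    subst this
    simp only [Int.cast_zero, zero_div, jT_zero]
    exact mem_zI
  · rw [if_neg h0]
    have hXpos : 0 < X := lt_of_not_ge h0
    obtain ⟨LX, hLX⟩ := tailPred_pos hXpos hp
    simp only [hLX]
    have hXn : ((X.toNat : ℕ) : ℤ) = X := Int.toNat_of_nonneg hX
    have hXr : ((X.toNat : ℕ) : ℝ) = (X : ℝ) := by exact_mod_cast hXn
    have hXn0 : 0 < X.toNat := by omega
    have hD' : (0 : ℝ) < D := by exact_mod_cast hD
    have hE' : (0 : ℝ) < E := by exact_mod_cast hE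
    have hXr0 : (0 : ℝ) < (X : ℝ) := by exact_mod_cast hXpos
    have hx : (0 : ℝ) < (X : ℝ) / D := by positivity
    have hU : (0 : ℝ) < (A : ℝ) / E := by positivity
    have hlogX : MI.mem SC (Real.log (X : ℝ)) LX := by rw [← hXr]; exact MI.mem_logNat2 SC_pos hLX
    have hlx : MI.mem SC (Real.log ((X : ℝ) / D)) (LX.sub LD) := by
      rw [Real.log_div hXr0.ne' hD'.ne']; exact MI.mem_sub hlogX hLD
    rw [jT_tail _ hU]
    have eU : ((A * D : ℕ) : ℝ) / ((E * D : ℕ) : ℝ) = (A : ℝ) / E := by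
      push_cast; rw [mul_div_mul_right _ _ hD'.ne']
    have eUx : ((A * X.toNat : ℕ) : ℝ) / ((E * D : ℕ) : ℝ) = (A : ℝ) / E * ((X : ℝ) / D) := by
      push_cast; rw [hXr, frac_mul_frac]
    by_cases hDX : D ≤ X.toNat
    · -- `x ≥ 1`: `U ≤ Ux`
      rw [if_pos hDX]
      have hδ := deltaE_sound (M := E * D) (P := A * D) (Q := A * X.toNat) (Nat.mul_pos hE hD)
        (Nat.mul_pos hA hD) (Nat.mul_le_mul_left _ hDX)
      rw [eU, eUx] at hδ
      have h := MI.mem_divNat (MI.mem_mulInt (MI.mem_add hlx hδ) X) hD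
      convert h using 1
      ring
    · -- `x < 1`: `Ux < U`, use `δ(U,Ux) = −δ(Ux,U)`
      rw [if_neg hDX]
      have hδ := deltaE_sound (M := E * D) (P := A * X.toNat) (Q := A * D) (Nat.mul_pos hE hD)
        (Nat.mul_pos hA hXn0) (Nat.mul_le_mul_left _ (le_of_not_ge hDX))
      rw [eU, eUx] at hδ
      rw [dG_symm hU (mul_pos hU hx)]
      have h := MI.mem_divNat (MI.mem_mulInt (MI.mem_sub hlx hδ) X) hD
      convert h using 1
      ring

/-! ### The member pattern -/

/-- Sums over `Fin 7`. -/
theorem mem_sum7 {F : Fin 7 → ℝ} {G : Fin 7 → MI} (h : ∀ i, MI.mem SC (F i) (G i)) :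
    MI.mem SC (∑ i : Fin 7, F i) (sum7 G) := by
  rw [Fin.sum_univ_seven]
  exact MI.mem_add (MI.mem_add (MI.mem_add (MI.mem_add (MI.mem_add (MI.mem_add (h 0) (h 1)) (h 2)) (h 3))
    (h 4)) (h 5)) (h 6)

/-- What `all7` says. -/
theorem all7_spec {b : Fin 7 → Bool} (h : all7 b = true) : ∀ i, b i = true := by
  simp only [all7, Bool.and_eq_true] at h
  obtain ⟨⟨⟨⟨⟨⟨h0, h1⟩, h2⟩, h3⟩, h4⟩, h5⟩, h6⟩ := h
  intro i
  fin_cases i <;> assumption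

/-- **Soundness of the member pattern**: if `f X` encloses `g(X/D)` at every non-negative numerator passing `pr`, then
`memShapeEnc pt v w f` encloses `memShape s v w g` at the direction `s = pt/D` of the closed box (`pt_i ≤ pt₀ = D`). -/
theorem memShapeEnc_sound {D : ℕ} (hD : 0 < D) {pt : List ℕ} {s : Fin 8 → ℝ}
    (ht : ∀ i : Fin 8, s i * D = ((pt.getD i 0 : ℕ) : ℝ)) (h0 : pt.getD 0 0 = D)
    (hle : ∀ i : Fin 8, pt.getD i 0 ≤ D) (v w : Fin 7) {f : ℤ → MI} {g : ℝ → ℝ} {pr : ℤ → Bool}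
    (hf : ∀ X : ℤ, 0 ≤ X → pr X = true → MI.mem SC (g ((X : ℝ) / D)) (f X))
    (hall : memShapeAll pt v w pr = true) :
    MI.mem SC (memShape s v w g) (memShapeEnc pt v w f) := by
  have hD' : (0 : ℝ) < D := by exact_mod_cast hD
  have hs : ∀ i : Fin 8, s i = ((Pz pt i : ℤ) : ℝ) / D := fun i => by
    rw [eq_div_iff hD'.ne', ht i]; simp [Pz]
  have hcmp : ∀ i j : Fin 8, s i ≤ s j ↔ Pz pt i ≤ Pz pt j := fun i j => by
    rw [hs i, hs j, div_le_div_iff_of_pos_right hD']; exact_mod_cast Iff.rfl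
  have hP0 : ∀ i : Fin 8, Pz pt i ≤ Pz pt 0 := fun i => by
    simp only [Pz, Fin.val_zero, h0]; exact_mod_cast hle i
  have hPnn : ∀ i : Fin 8, 0 ≤ Pz pt i := fun i => by simp [Pz]
  -- generic sum / difference features
  have gadd : ∀ a b : Fin 8, pr (Pz pt a + Pz pt b) = true →
      MI.mem SC (g (s a + s b)) (f (Pz pt a + Pz pt b)) := fun a b h => by
    have e : s a + s b = (((Pz pt a + Pz pt b : ℤ)) : ℝ) / D := by rw [hs a, hs b]; push_cast; ring
    rw [e]; exact hf _ (by linarith [hPnn a, hPnn b]) h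
  have gsub : ∀ a b : Fin 8, Pz pt b ≤ Pz pt a → pr (Pz pt a - Pz pt b) = true →
      MI.mem SC (g (s a - s b)) (f (Pz pt a - Pz pt b)) := fun a b hab h => by
    have e : s a - s b = (((Pz pt a - Pz pt b : ℤ)) : ℝ) / D := by rw [hs a, hs b]; push_cast; ring
    rw [e]; exact hf _ (by linarith) h
  -- unpack the predicate facts
  simp only [memShapeAll, Bool.and_eq_true] at hall
  obtain ⟨⟨⟨⟨⟨⟨⟨⟨⟨⟨⟨⟨p1, p2⟩, p3⟩, p4⟩, p5⟩, p6⟩, p7⟩, p8⟩, p9⟩, p10⟩, p11⟩, p12⟩, p13⟩ := hall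
  unfold memShape memShapeEnc
  refine MI.mem_sub (MI.mem_sub (MI.mem_add (MI.mem_sub (MI.mem_add (MI.mem_sub (MI.mem_add
    (gadd _ _ p1) (gsub _ _ (hP0 _) p2)) ?_) ?_) ?_) ?_) (gsub _ _ (hP0 _) p12)) (gsub _ _ (hP0 _) p13)
  · -- `2 · g(x_v + x_w)`
    have h := MI.mem_mulInt (gadd _ _ p3) 2
    convert h using 1
    push_cast; ring
  · -- the reoriented differences
    refine mem_sum7 fun i => ?_
    have hb := all7_spec p4 i
    by_cases hiw : i = v ∨ i = w
    · rw [if_pos hiw, if_pos hiw]; exact mem_zI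
    · rw [if_neg hiw, if_neg hiw]
      simp only [if_neg hiw] at hb
      by_cases hc : Pz pt i.succ ≤ Pz pt v.succ
      · rw [if_pos ((hcmp _ _).mpr hc), if_pos hc]
        rw [if_pos hc] at hb
        exact gsub _ _ hc hb
      · rw [if_neg (fun h => hc ((hcmp _ _).mp h)), if_neg hc]
        rw [if_neg hc] at hb
        exact MI.mem_neg (gsub _ _ (le_of_not_ge hc) hb)
  · -- the pair sums with `x_v`
    refine mem_sum7 fun j => ?_
    have hb := all7_spec p5 j
    by_cases hjw : j = v ∨ j = w
    · rw [if_pos hjw, if_pos hjw]; exact mem_zI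
    · rw [if_neg hjw, if_neg hjw]
      simp only [if_neg hjw] at hb
      exact gadd _ _ hb
  · -- the six reference-path sums
    exact MI.mem_add (MI.mem_add (MI.mem_add (MI.mem_add (MI.mem_add (gadd _ _ p6) (gadd _ _ p7))
      (gadd _ _ p8)) (gadd _ _ p9)) (gadd _ _ p10)) (gadd _ _ p11)

/-- The member pattern is linear in `g`: differences. -/
theorem memShape_sub (s : Fin 8 → ℝ) (v w : Fin 7) (g h : ℝ → ℝ) :
    memShape s v w g - memShape s v w h = memShape s v w (fun x => g x - h x) := by
  unfold memShape
  have e1 : (∑ i : Fin 7, if i = v ∨ i = w then (0 : ℝ) else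
      if s i.succ ≤ s v.succ then g (s v.succ - s i.succ) else -g (s i.succ - s v.succ))
      - (∑ i : Fin 7, if i = v ∨ i = w then (0 : ℝ) else
      if s i.succ ≤ s v.succ then h (s v.succ - s i.succ) else -h (s i.succ - s v.succ))
      = ∑ i : Fin 7, if i = v ∨ i = w then (0 : ℝ) else
      if s i.succ ≤ s v.succ then (g (s v.succ - s i.succ) - h (s v.succ - s i.succ))
      else -(g (s i.succ - s v.succ) - h (s i.succ - s v.succ)) := by
    rw [← Finset.sum_sub_distrib]
    refine Finset.sum_congr rfl fun i _ => ?_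
    split_ifs <;> ring
  have e2 : (∑ j : Fin 7, if j = v ∨ j = w then (0 : ℝ) else g (s v.succ + s j.succ))
      - (∑ j : Fin 7, if j = v ∨ j = w then (0 : ℝ) else h (s v.succ + s j.succ))
      = ∑ j : Fin 7, if j = v ∨ j = w then (0 : ℝ) else (g (s v.succ + s j.succ) - h (s v.succ + s j.succ)) := by
    rw [← Finset.sum_sub_distrib]
    refine Finset.sum_congr rfl fun j _ => ?_
    split_ifs <;> ring
  rw [← e1, ← e2]
  ring

/-- The flip count read off the integers equals `memC` at `s = pt/D`. -/
theorem memC_eq_cnt {D : ℕ} (hD : 0 < D) {pt : List ℕ} {s : Fin 8 → ℝ}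
    (ht : ∀ i : Fin 8, s i * D = ((pt.getD i 0 : ℕ) : ℝ)) (v w : Fin 7) :
    memC s v w = (cnt pt v w : ℝ) := by
  have hD' : (0 : ℝ) < D := by exact_mod_cast hD
  have hs : ∀ i : Fin 8, s i = ((Pz pt i : ℤ) : ℝ) / D := fun i => by
    rw [eq_div_iff hD'.ne', ht i]; simp [Pz]
  have hcmp : ∀ i j : Fin 8, (s i ≤ s j) = (Pz pt i ≤ Pz pt j) := fun i j => by
    rw [hs i, hs j, div_le_div_iff_of_pos_right hD']; exact propext (by exact_mod_cast Iff.rfl)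
  simp only [memC, cnt, Fin.sum_univ_seven, hcmp]
  push_cast
  rfl

end LemmaFWin

end Summit.KontsevichZagierPeriods.Zeta5Search.Barrier.ConeGamma
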